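import Summits.BirchSwinnertonDyer.BirchSwinnertonDyer.Theorems.UniversalToricDescentToricKernelAtThree
import Summits.BirchSwinnertonDyer.BirchSwinnertonDyer.Theorems.UniversalToricDescentWildSplitWaldspurgerAtThreeFlat
import Summits.BirchSwinnertonDyer.Rank1Residual.X11b.RouteR1IntReceptacle
import HarnessLib

/-!
# Route `UniversalToricDescent`: the KERNEL over the ♭-receptacle `𝓞_{ℂ₃}⟦T⟧` — option (A) of the crux-#4 repair is
# TURNKEY: with cruxes #2/#3 re-typed over `PowerSeries 𝓞_ℂ_[3]` / `R1.IsBDPLFunctionInt` / `R1.toCpInt`, crux #4 is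
# DISCHARGED by the two refereed inputs (Hsieh any level, LZZ additive) and the Jetchev–Skinner–Wan §7.4 assembly at
# the wild split prime `3` goes through verbatim (`R₀` is not load-bearing)

Prover seat `bsd-potss-kmc` (g19), 2026-08-27, EVIDENCE for the steward's decision on stmt-BirchSwinnertonDyer-20385
(FINDING-UTD-20385-kmc-g19 §3 (A)). HONEST FRAMING: THEOREMS ONLY (0 definitions, 0 named facts, 0 `sorry`). Nothing of
the route is edited or closed by this file; the ♭-texts of cruxes #2/#3 appear as DISPLAYED HYPOTHESES (`hT♭`, `hI♭`) of
`toricKernelAtThree_flat`, spelled exactly as the `--restate` would render them (frame `Q : PowerSeries 𝓞_ℂ_[3]`,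
`X11b.R1.IsBDPLFunctionInt 3 ι′ 𝔭 κ γ f Ω_K Ω_p Q`, ideal image along `PowerSeries.map (X11b.R1.toCpInt 3)`); crux #4
does NOT appear — it is replaced by the refereed inputs `hA` (Hsieh 2014 Thm A, any level) and `hL` (Liu–Zhang–Zhang
2018 Thm 1.5.1/1.5.3, additive) through the companion file's `wildSplitWaldspurgerAtThree_flat`. The proof is
utd-p3 g0's `universalToricDescent_toricKernelAtThree_proof` (p533077) with the two norm receptacles re-read over
`𝓞_{ℂ₃}⟦T⟧` (§1) and nothing else changed. BSD₃ is proved for no curve by any of this (the ♭-cruxes #2/#3 and the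
residuals #5-inputs/#6 are hypotheses).

* §1 `int_two_mul_valuation_le_of_map_mem_span` / `int_valuation_le_two_mul_of_mem_span_map` — the algebra of the
  two halves over `𝓞_{ℂ_p}⟦T⟧` (any `p`): `map f ∈ (Q)` (resp. `Q ∈ (map f)`) and `Q(0) = u·x²`, `‖u‖ = 1`
  ⟹ `2·ord x ≤ ord f(0)` (resp. `≥`) — BED's `two_mul_valuation_le_int` and the ♭-twin of K1's
  `SchneiderFree.Upper.two_mul_valuation_ge_of_hasValueAt_sq_unit`, re-proved here to keep this module free of other
  routes' files.
* §2 **`toricKernelAtThree_flat`**: `hA → hL → ToricPublishedInputs → hT♭ → hI♭ → WildSplitControlAtThree →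
  WildRankZeroTwistAtThree → ∀ W` (wild at `3`, `r_an = 1`, `ρ̄₃` onto, a semistable onto twin) `→ BSDp W 3` — the text
  of `ToricKernelAtThree` with `ToricTransportModThree`/`TwinSplitIMCAtThree` ♭-typed and `WildSplitWaldspurgerAtThree`
  ABSENT.

References: [JetchevSkinnerWan2017] §7.4.1; [Castella2018] Thm 2.3, §5 (5.1)–(5.3); [Hsieh2014] Thm A; [LiuZhangZhang2018]
Thm 1.5.1/1.5.3; [GrossZagier1986] I.(6.3); [FriedbergHoffstein1995] Thm B.
-/

noncomputable section

open scoped Classical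

set_option linter.dupNamespace false
set_option autoImplicit false

namespace Summit.BirchSwinnertonDyer.BirchSwinnertonDyer.Theorems.UniversalToricDescentWaldspurgerFlat

open WeierstrassCurve NumberField IsDedekindDomain Field PowerSeries
  Literature.NumberTheory.EllipticCurves
  Literature.NumberTheory.EllipticCurves.ModularForms
  Literature.NumberTheory.EllipticCurves.Rank1Residual
  Literature.NumberTheory.EllipticCurves.KrizLi2019
  Literature.NumberTheory.GaloisRepresentations
  Summit.BirchSwinnertonDyer.Rank1Residual
  Summit.BirchSwinnertonDyer.Rank1Residual.Additive
  Summit.BirchSwinnertonDyer.Rank1Residual.X11b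
  Summit.BirchSwinnertonDyer.Rank1Residual.X11b.AcSelmer
  Summit.BirchSwinnertonDyer.Rank1Residual.X11b.Halves
  Summit.BirchSwinnertonDyer.Rank1Residual.X11b.CongruenceLimit
  Summit.BirchSwinnertonDyer.BirchSwinnertonDyer.Theses.UniversalToricDescent

/-! ### §1 The two halves over `𝓞_{ℂ_p}⟦T⟧` -/

section IntHalves

variable {p : ℕ} [Fact p.Prime]

/-- **Lower half over the wide receptacle.** `f ∈ Λ = ℤ_p⟦T⟧` with `f(0) ≠ 0`, its image in `𝓞_{ℂ_p}⟦T⟧` lies in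
`(Q)`, and `Q(0) = u·x²` with `‖u‖ = 1` (`x ∈ ℚ_p`) ⟹ `x ≠ 0` and `2·ord_p x ≤ ord_p f(0)` (norms:
`‖f(0)‖ = ‖G(0)‖·‖Q(0)‖ ≤ ‖x‖²`). Same content as BED's `two_mul_valuation_le_int`. [folklore] -/
theorem int_two_mul_valuation_le_of_map_mem_span {f : IwasawaAlgebra p} (hf0 : constantCoeff f ≠ 0)
    {Q : PowerSeries (PadicComplexInt p)} (hfQ : PowerSeries.map (R1.toCpInt p) f ∈ Ideal.span {Q})
    {u : ℂ_[p]} (hu : ‖u‖ = 1) {x : ℚ_[p]}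
    (hQ : IntSeries.HasValueAt Q 0 (u * (algebraMap ℚ_[p] ℂ_[p] x) ^ 2)) :
    x ≠ 0 ∧ 2 * x.valuation ≤ ((constantCoeff f).valuation : ℤ) := by
  have hp : p.Prime := Fact.out
  have hQ0 : u * (algebraMap ℚ_[p] ℂ_[p] x) ^ 2 = ((constantCoeff Q : PadicComplexInt p) : ℂ_[p]) :=
    R1.intSeries_eq_constantCoeff_of_hasValueAt_zero p hQ
  obtain ⟨G, hG⟩ := Ideal.mem_span_singleton'.mp hfQ
  have hfac : algebraMap ℚ_[p] ℂ_[p] ((constantCoeff f : ℤ_[p]) : ℚ_[p]) =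
      ((constantCoeff G : PadicComplexInt p) : ℂ_[p]) * ((constantCoeff Q : PadicComplexInt p) : ℂ_[p]) := by
    rw [← R1.coe_toCpInt, ← constantCoeff_map_apply (R1.toCpInt p) f, ← hG, map_mul, MulMemClass.coe_mul]
  have hp1 : (1 : ℝ) < p := by exact_mod_cast hp.one_lt
  have hnormf : ‖((constantCoeff f : ℤ_[p]) : ℚ_[p])‖ ≤ ‖x‖ ^ 2 := by
    calc ‖((constantCoeff f : ℤ_[p]) : ℚ_[p])‖
        = ‖algebraMap ℚ_[p] ℂ_[p] ((constantCoeff f : ℤ_[p]) : ℚ_[p])‖ := (norm_algebraMap' ℂ_[p] _).symm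
      _ = ‖((constantCoeff G : PadicComplexInt p) : ℂ_[p])‖ * ‖((constantCoeff Q : PadicComplexInt p) : ℂ_[p])‖ := by
          rw [hfac, norm_mul]
      _ ≤ 1 * ‖((constantCoeff Q : PadicComplexInt p) : ℂ_[p])‖ :=
          mul_le_mul_of_nonneg_right (R1.norm_coe_padicComplexInt_le_one p _) (norm_nonneg _)
      _ = ‖u‖ * ‖algebraMap ℚ_[p] ℂ_[p] x‖ ^ 2 := by rw [one_mul, ← hQ0, norm_mul, norm_pow]
      _ = ‖x‖ ^ 2 := by rw [hu, one_mul, norm_algebraMap']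
  have hx0 : x ≠ 0 := by
    intro hx
    rw [hx, norm_zero, zero_pow two_ne_zero] at hnormf
    exact hf0 (PadicInt.coe_eq_zero.mp (norm_eq_zero.mp (le_antisymm hnormf (norm_nonneg _))))
  refine ⟨hx0, ?_⟩
  rw [← PadicInt.norm_def, PadicInt.norm_eq_zpow_neg_valuation hf0, Padic.norm_eq_zpow_neg_valuation hx0] at hnormf
  have hrhs : ((p : ℝ) ^ (-x.valuation)) ^ 2 = (p : ℝ) ^ (-(2 * x.valuation)) := by
    rw [← zpow_natCast ((p : ℝ) ^ (-x.valuation)) 2, ← zpow_mul]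
    congr 1
    push_cast
    ring
  rw [hrhs, zpow_le_zpow_iff_right₀ hp1] at hnormf
  omega

/-- **Upper half over the wide receptacle.** `f ∈ Λ` with `f(0) ≠ 0`, `Q ∈ (f)·𝓞_{ℂ_p}⟦T⟧`, `Q(0) = u·x²` with `‖u‖ = 1`
and `x ≠ 0` ⟹ `ord_p f(0) ≤ 2·ord_p x` (norms: `‖x‖² = ‖Q(0)‖ = ‖G(0)‖·‖f(0)‖ ≤ ‖f(0)‖`). The ♭-twin of K1's
`SchneiderFree.Upper.two_mul_valuation_ge_of_hasValueAt_sq_unit`. [folklore] -/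
theorem int_valuation_le_two_mul_of_mem_span_map {f : IwasawaAlgebra p} (hf0 : constantCoeff f ≠ 0)
    {Q : PowerSeries (PadicComplexInt p)} (hQf : Q ∈ Ideal.span {PowerSeries.map (R1.toCpInt p) f})
    {u : ℂ_[p]} (hu : ‖u‖ = 1) {x : ℚ_[p]} (hx : x ≠ 0)
    (hQ : IntSeries.HasValueAt Q 0 (u * (algebraMap ℚ_[p] ℂ_[p] x) ^ 2)) :
    ((constantCoeff f).valuation : ℤ) ≤ 2 * x.valuation := by
  have hQ0 : u * (algebraMap ℚ_[p] ℂ_[p] x) ^ 2 = ((constantCoeff Q : PadicComplexInt p) : ℂ_[p]) :=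
    R1.intSeries_eq_constantCoeff_of_hasValueAt_zero p hQ
  obtain ⟨G, hG⟩ := Ideal.mem_span_singleton'.mp hQf
  have hfac : ((constantCoeff Q : PadicComplexInt p) : ℂ_[p]) =
      ((constantCoeff G : PadicComplexInt p) : ℂ_[p]) *
        algebraMap ℚ_[p] ℂ_[p] ((constantCoeff f : ℤ_[p]) : ℚ_[p]) := by
    rw [← R1.coe_toCpInt, ← constantCoeff_map_apply (R1.toCpInt p) f, ← hG, map_mul, MulMemClass.coe_mul]
  have hnorm : ‖x‖ ^ 2 ≤ ‖((constantCoeff f : ℤ_[p]) : ℚ_[p])‖ := by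
    calc ‖x‖ ^ 2 = ‖algebraMap ℚ_[p] ℂ_[p] x‖ ^ 2 := by rw [norm_algebraMap']
      _ = ‖u‖ * ‖algebraMap ℚ_[p] ℂ_[p] x‖ ^ 2 := by rw [hu, one_mul]
      _ = ‖((constantCoeff Q : PadicComplexInt p) : ℂ_[p])‖ := by rw [← hQ0, norm_mul, norm_pow]
      _ = ‖((constantCoeff G : PadicComplexInt p) : ℂ_[p])‖ *
            ‖algebraMap ℚ_[p] ℂ_[p] ((constantCoeff f : ℤ_[p]) : ℚ_[p])‖ := by rw [hfac, norm_mul]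
      _ ≤ 1 * ‖algebraMap ℚ_[p] ℂ_[p] ((constantCoeff f : ℤ_[p]) : ℚ_[p])‖ :=
          mul_le_mul_of_nonneg_right (R1.norm_coe_padicComplexInt_le_one p _) (norm_nonneg _)
      _ = ‖((constantCoeff f : ℤ_[p]) : ℚ_[p])‖ := by rw [one_mul, norm_algebraMap']
  exact SchneiderFree.Upper.valuation_le_two_mul_of_sq_le p hf0 hx hnorm

end IntHalves

/-! ### §2 The kernel over `𝓞_{ℂ₃}⟦T⟧`, crux #4 discharged -/

/-- **The UTD kernel in the ♭-receptacle, with crux #4 DISCHARGED by the two refereed inputs.** Hypotheses, in the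
order of `ToricKernelAtThree`: `hA` (Hsieh 2014 Thm A, any level) and `hL` (Liu–Zhang–Zhang 2018 Thm 1.5.1/1.5.3,
additive) IN PLACE OF crux #4; `ToricPublishedInputs` (as filed); `hT♭` = crux #2 `ToricTransportModThree` with both
frame clauses ♭-typed; `hI♭` = crux #3 `TwinSplitIMCAtThree` ♭-typed; `WildSplitControlAtThree` and
`WildRankZeroTwistAtThree` (as filed, frame-free). Conclusion: the conclusion of `ToricKernelAtThree` verbatim.
Proof = p533077's: Friedberg–Hoffstein `K` (Heegner for `N(E)`, `N(E′)`, `2` split, odd `d_K`), Heegner point,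
Gross–Zagier, Kolyvagin, frame `(κ, γ, 𝔭, 𝔭′)`, ♭-frame and UNIT-NORM value at `𝔭`
(`wildSplitWaldspurgerAtThree_flat hA hL`), the twin's ♭-IMC at `(ι′, 𝔭)` strict at `𝔭′`, transport ⟹ EQUALITY for
`E` at the ♭-frame, control at `𝔭′`, `(log_{𝔭′}P)² = (log_𝔭 P)²`, both halves by §1 ⟹ exact index at slack `v₃(c)`
⟹ p528981. CONDITIONAL on every displayed hypothesis; nothing closed. [cite: JetchevSkinnerWan2017, §7.4.1 (arXiv:1512.06894 p. 30)]
[cite: Castella2018, Thm. 2.3 and §5 (5.1)–(5.3)] [cite: Hsieh2014, Thm. A p. 712 (Doc. Math. 19)]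
[cite: LiuZhangZhang2018, Thm 1.5.1 and Thm 1.5.3 (Duke Math. J. 167 pp. 748–749)] -/
theorem toricKernelAtThree_flat
    (hA : Hsieh2014.thmA_exists_isHsiehLFunction_unrPeriod_anyLevel)
    (hL : LiuZhangZhang2018.thm151_thm153_modularCurve_heegnerVector_additive)
    (hF : ToricPublishedInputs)
    (hT : ∀ (W : WeierstrassCurve ℚ) [W.IsElliptic] [W.IsGloballyMinimal] (W' : WeierstrassCurve ℚ) [W'.IsElliptic]
      [W'.IsGloballyMinimal] (N N' : ℕ) [NeZero N] [NeZero N'] (K : Type) [Field K] [NumberField K]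
      (Dt : ModularParametrizationData W N) (Dt' : ModularParametrizationData W' N'),
      ClassO6 W 3 → W.HasSurjectiveModNGaloisRep 3 → W.analyticRank = 1 → W.conductorNorm ℤ = N →
      O6.ModPCongruent W' W 3 → ¬ Addv W' 3 → W'.conductorNorm ℤ = N' → IsImaginaryQuadratic K →
      SatisfiesHeegnerHypothesis N K → SatisfiesHeegnerHypothesis N' K →
      ∀ (κ : ZpExtension K 3), κ.IsAnticyclotomic → ∀ (γ : Field.absoluteGaloisGroup K) [Fact (κ.IsTopGenerator γ)]
        (𝔭 : HeightOneSpectrum (𝓞 K)), ((3 : ℕ) : 𝓞 K) ∈ 𝔭.asIdeal → 𝔭.asIdeal.ramificationIdx (𝓞 ℚ) = 1 →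
        𝔭.asIdeal.inertiaDeg (𝓞 ℚ) = 1 → ∀ (𝔭' : HeightOneSpectrum (𝓞 K)), ((3 : ℕ) : 𝓞 K) ∈ 𝔭'.asIdeal → 𝔭' ≠ 𝔭 →
        ∀ (ι' : PadicAlgCl 3 ≃+* ℂ), SchneiderFree.BranchInducesPrime 3 ι' 𝔭 →
        (∃ (ΩK : ℂ) (Ωp : ℂ_[3]) (Q' : PowerSeries (PadicComplexInt 3)), ΩK ≠ 0 ∧ Ωp ≠ 0 ∧
          R1.IsBDPLFunctionInt 3 ι' 𝔭 κ γ Dt'.f ΩK Ωp Q') →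
        (∀ (ΩK : ℂ) (Ωp : ℂ_[3]) (Q' : PowerSeries (PadicComplexInt 3)), ΩK ≠ 0 → Ωp ≠ 0 →
          R1.IsBDPLFunctionInt 3 ι' 𝔭 κ γ Dt'.f ΩK Ωp Q' →
          (XAc.charIdeal (W'.baseChange K) 3 κ 𝔭' ∅ γ).map (PowerSeries.map (R1.toCpInt 3)) = Ideal.span {Q'}) →
        ∀ (ΩK : ℂ) (Ωp : ℂ_[3]) (Q : PowerSeries (PadicComplexInt 3)), ΩK ≠ 0 → Ωp ≠ 0 →
          R1.IsBDPLFunctionInt 3 ι' 𝔭 κ γ Dt.f ΩK Ωp Q →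
          (XAc.charIdeal (W.baseChange K) 3 κ 𝔭' ∅ γ).map (PowerSeries.map (R1.toCpInt 3)) = Ideal.span {Q})
    (hI : ∀ (W' : WeierstrassCurve ℚ) [W'.IsElliptic] [W'.IsGloballyMinimal] (N' : ℕ) [NeZero N'] (K : Type) [Field K]
      [NumberField K] (Dt' : ModularParametrizationData W' N'), ¬ Addv W' 3 → W'.HasSurjectiveModNGaloisRep 3 →
      W'.conductorNorm ℤ = N' → IsImaginaryQuadratic K → SatisfiesHeegnerHypothesis N' K →
      ∀ (κ : ZpExtension K 3), κ.IsAnticyclotomic → ∀ (γ : Field.absoluteGaloisGroup K) [Fact (κ.IsTopGenerator γ)]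
        (𝔭 : HeightOneSpectrum (𝓞 K)), ((3 : ℕ) : 𝓞 K) ∈ 𝔭.asIdeal → 𝔭.asIdeal.ramificationIdx (𝓞 ℚ) = 1 →
        𝔭.asIdeal.inertiaDeg (𝓞 ℚ) = 1 → ∀ (𝔭' : HeightOneSpectrum (𝓞 K)), ((3 : ℕ) : 𝓞 K) ∈ 𝔭'.asIdeal → 𝔭' ≠ 𝔭 →
        ∀ (ι' : PadicAlgCl 3 ≃+* ℂ), SchneiderFree.BranchInducesPrime 3 ι' 𝔭 →
        (∃ (ΩK : ℂ) (Ωp : ℂ_[3]) (Q' : PowerSeries (PadicComplexInt 3)), ΩK ≠ 0 ∧ Ωp ≠ 0 ∧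
          R1.IsBDPLFunctionInt 3 ι' 𝔭 κ γ Dt'.f ΩK Ωp Q') ∧
        (∀ (ΩK : ℂ) (Ωp : ℂ_[3]) (Q' : PowerSeries (PadicComplexInt 3)), ΩK ≠ 0 → Ωp ≠ 0 →
          R1.IsBDPLFunctionInt 3 ι' 𝔭 κ γ Dt'.f ΩK Ωp Q' →
          (XAc.charIdeal (W'.baseChange K) 3 κ 𝔭' ∅ γ).map (PowerSeries.map (R1.toCpInt 3)) = Ideal.span {Q'}))
    (hC : WildSplitControlAtThree) (hZ : WildRankZeroTwistAtThree) :
    ∀ (W : WeierstrassCurve ℚ) [W.IsElliptic] [W.IsGloballyMinimal], ClassO6 W 3 → W.analyticRank = 1 →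
      W.HasSurjectiveModNGaloisRep 3 →
      (∃ (W' : WeierstrassCurve ℚ) (_ : W'.IsElliptic) (_ : W'.IsGloballyMinimal),
        O6.ModPCongruent W' W 3 ∧ ¬ Addv W' 3 ∧ W'.HasSurjectiveModNGaloisRep 3) → BSDp W 3 := by
  intro W _ _ hO6 hr hsurj htwin
  obtain ⟨W', hW'e, hW'm, hcong, hW'ss, hW'surj⟩ := htwin
  obtain ⟨hGZ, hKo, hGZK, hmod, hmodP, -, hGZ73, hFH, hpar, hHP⟩ := hF
  haveI hN0 : NeZero (W.conductorNorm ℤ) := ⟨W.conductorNorm_pos_holds.ne'⟩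
  haveI hN0' : NeZero (W'.conductorNorm ℤ) := ⟨W'.conductorNorm_pos_holds.ne'⟩
  -- (a) DATA. parity: `r_an = 1` is odd, so `w(E) = -1`
  have hw : W.rootNumber = -1 := by
    rcases W.rootNumber_eq_one_or with h | h
    · exfalso
      have heven : Even W.analyticRank := (hpar W).mpr h
      rw [hr] at heven
      exact Nat.not_even_one heven
    · exact h
  -- Friedberg–Hoffstein with auxiliary modulus `2·N(E′)`: Heegner for `N(E)`, `N(E′)`, and `2` split
  obtain ⟨K, _, _, hK, -, hHN, hH2N', hLt⟩ :=
    hFH W hw (2 * W'.conductorNorm ℤ) (mul_ne_zero two_ne_zero hN0'.out) 0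
  have hHN' : SatisfiesHeegnerHypothesis (W'.conductorNorm ℤ) K :=
    SatisfiesHeegnerHypothesis.of_dvd (dvd_mul_left _ 2) hH2N'
  have hodd : Odd (NumberField.discr K) := by
    have h8 := Literature.SatisfiesHeegnerHypothesis.discr_emod_eight hK.1 hH2N' (dvd_mul_right 2 _)
    rw [Int.odd_iff]; omega
  -- `3 ∣ N(E)` (additive) splits in `K`
  have h3N : 3 ∣ W.conductorNorm ℤ :=
    (W.dvd_conductorNorm_iff_not_hasGoodReductionAtPrime 3).mpr (not_good_of_addv W 3 hO6.2.1)
  have hsplit : SplitsIn K 3 := hHN 3 Nat.prime_three h3N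
  -- the Heegner point over `K` and its data; non-torsion by Gross–Zagier
  obtain ⟨P, Dt, H, ι, hP⟩ := hHP W K hK hHN
  have hL0 : W.entireLFunction 1 = 0 := entireLFunction_one_eq_zero_of_analyticRank_eq_one hr
  obtain ⟨-, hderiv⟩ := leadingLCoeff_eq_deriv_of_analyticRank_eq_one hr
  have hLK : LDerivEK W K ≠ 0 := by
    rw [lDerivEK_eq_deriv_mul W K hmod hL0]; exact mul_ne_zero hderiv hLt
  have hnt : ¬ IsOfFinAddOrder P :=
    (lDerivEK_ne_zero_iff_not_isOfFinAddOrder W (W.conductorNorm ℤ) K (hGZ _ W K) hK hHN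
      ⟨Dt, H, ι, hP⟩).mp hLK
  -- Kolyvagin: `rank E(K) = 1`, `Ш(E/K)` finite
  obtain ⟨hrk, hfin⟩ := hKo (W.conductorNorm ℤ) W K hK hHN ⟨Dt, H, ι, hP⟩ hnt
  -- the twin's parametrisation datum (modularity)
  obtain ⟨Dt'⟩ := hmodP W'
  -- a frame `(κ, γ, 𝔭)` and the other prime `𝔭′ ≠ 𝔭` above `3`
  obtain ⟨κ, γ, -, hκ, hγ, -⟩ := X11b.exists_anticyclotomic_generator_prime (p := 3) hK
  haveI : Fact (κ.IsTopGenerator γ) := ⟨hγ⟩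
  obtain ⟨𝔭, h𝔭, he, hf⟩ := X11b.exists_degreeOnePrime_of_splitsIn K 3 hK.1 hsplit
  obtain ⟨𝔭', hne, h𝔭', he', hf'⟩ := X11b.Three.exists_ne_degreeOne_prime hK.1 h𝔭 he hf
  -- (b) PLUMBING. ♭-frame and unit-norm value at `(κ, γ, 𝔭)` — crux #4 DISCHARGED (Hsieh + LZZ)
  obtain ⟨ι', hind, ΩK, Ωp, Q, hΩK, hΩp, hBDP, u, hu, hval⟩ :=
    wildSplitWaldspurgerAtThree_flat hA hL W (W.conductorNorm ℤ) K Dt H ι P hO6 hsurj hr rfl hK hHN hLt hP hnt κ hκ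
      γ 𝔭 h𝔭 he hf
  -- the twin's ♭-IMC at `(ι′, 𝔭)` with `X_ac` strict at `𝔭′`
  obtain ⟨hex', hall'⟩ :=
    hI W' (W'.conductorNorm ℤ) K Dt' hW'ss hW'surj rfl hK hHN' κ hκ γ 𝔭 h𝔭 he hf 𝔭' h𝔭' hne ι' hind
  -- transport: ♭-IMC EQUALITY for `E` at the frame `Q`
  have heq : (XAc.charIdeal (W.baseChange K) 3 κ 𝔭' ∅ γ).map (PowerSeries.map (R1.toCpInt 3)) =
      Ideal.span {Q} :=
    hT W W' (W.conductorNorm ℤ) (W'.conductorNorm ℤ) K Dt Dt' hO6 hsurj hr rfl hcong hW'ss rfl hK hHN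
      hHN' κ hκ γ 𝔭 h𝔭 he hf 𝔭' h𝔭' hne ι' hind hex' hall' ΩK Ωp Q hΩK hΩp hBDP
  -- control EQUALITY at `𝔭′` (CTL₀ included)
  have hctl : SchneiderFree.AdditiveControlOnTreeAt 3 κ 𝔭' γ (embAt K 3 𝔭' h𝔭' he' hf') P :=
    hC W (W.conductorNorm ℤ) K Dt H ι P hO6 hsurj hr rfl hK hHN hLt hP hnt (hKo _ W K) κ hκ γ 𝔭'
      h𝔭' he' hf'
  obtain ⟨n, hn, hneq⟩ := hctl
  -- the value read through the logarithm at `𝔭′` (rank one: `(log_{𝔭′} P)² = (log_𝔭 P)²`)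
  have hc0 : Dt.c ≠ 0 := Dt.maninConstant_ne_zero_holds
  have hc0' : (Dt.c : ℚ_[3]) ≠ 0 := by exact_mod_cast hc0
  have hlog : logOmega W 3 (embAt K 3 𝔭' h𝔭' he' hf') P ≠ 0 := X11b.R1.logOmega_ne_zero W 3 _ hnt
  have hsq : (algebraMap ℚ_[3] ℂ_[3] (logOmega W 3 (embAt K 3 𝔭 h𝔭 he hf) P / (Dt.c : ℚ_[3]))) ^ 2 =
      (algebraMap ℚ_[3] ℂ_[3] (logOmega W 3 (embAt K 3 𝔭' h𝔭' he' hf') P / (Dt.c : ℚ_[3]))) ^ 2 := by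
    rw [← map_pow, ← map_pow, div_pow, div_pow,
      SchneiderFreeAdditiveX3.sq_logOmega_embAt_eq_of_rank_one W 3 hK.1 hrk h𝔭 he hf h𝔭' he' hf' P]
  have hval' : IntSeries.HasValueAt Q 0
      (u * (algebraMap ℚ_[3] ℂ_[3] (logOmega W 3 (embAt K 3 𝔭' h𝔭' he' hf') P / (Dt.c : ℚ_[3]))) ^ 2) := by
    rw [← hsq]; exact hval
  have hy0 : logOmega W 3 (embAt K 3 𝔭' h𝔭' he' hf') P / (Dt.c : ℚ_[3]) ≠ 0 := div_ne_zero hlog hc0'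
  -- both sockets at slack `v₃(c)` at the frame `(κ, 𝔭′, γ, embAt 𝔭′)`, by §1
  have hlow : SchneiderFree.AdditiveIMCLowerBDPOnTreeLeAt 3 κ 𝔭' γ (embAt K 3 𝔭' h𝔭' he' hf')
      (padicValNat 3 Dt.c.natAbs) P := by
    obtain ⟨htors, f, hfI, hf0, hfn⟩ := hn
    have hmem : PowerSeries.map (R1.toCpInt 3) f ∈ Ideal.span {Q} := by
      have h3 := heq.le
      rw [hfI, map_span_singleton_powerSeries] at h3
      exact (Ideal.span_singleton_le_iff_mem _).mp h3
    obtain ⟨-, hle⟩ := int_two_mul_valuation_le_of_map_mem_span hf0 hmem hu hval'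
    rw [div_eq_mul_inv, Padic.valuation_mul hlog (inv_ne_zero hc0'), Padic.valuation_inv,
      Padic.valuation_intCast, valuation_logOmega hlog, hfn] at hle
    refine ⟨n, ⟨htors, f, hfI, hf0, hfn⟩, ?_⟩
    simp only [padicValInt] at hle
    linarith
  have hup : SchneiderFree.Upper.AdditiveIMCUpperBDPOnTreeLeAt 3 κ 𝔭' γ (embAt K 3 𝔭' h𝔭' he' hf')
      (padicValNat 3 Dt.c.natAbs) P := by
    obtain ⟨htors, f, hfI, hf0, hfn⟩ := hn
    have hmem : Q ∈ Ideal.span {PowerSeries.map (R1.toCpInt 3) f} := by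
      have h3 := heq.ge
      rw [hfI, map_span_singleton_powerSeries] at h3
      exact (Ideal.span_singleton_le_iff_mem _).mp h3
    have hle := int_valuation_le_two_mul_of_mem_span_map hf0 hmem hu hy0 hval'
    rw [div_eq_mul_inv, Padic.valuation_mul hlog (inv_ne_zero hc0'), Padic.valuation_inv,
      Padic.valuation_intCast, valuation_logOmega hlog, hfn] at hle
    refine ⟨n, ⟨htors, f, hfI, hf0, hfn⟩, ?_⟩
    simp only [padicValInt] at hle
    linarith
  -- the EXACT index at slack `v₃(c)` (both halves), by K1's links with the control equality
  have hlo : SchneiderFree.IndexLowerBoundLeAt W 3 K P (padicValNat 3 Dt.c.natAbs) :=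
    SchneiderFreeAdditiveX3.indexLowerBoundLeAt_of_imcLowerLe_of_control rfl hK hHN hfin hlow
      ⟨n, hn, hneq⟩
  have hupI : SchneiderFree.Upper.IndexUpperBoundLeAt W 3 K P (padicValNat 3 Dt.c.natAbs) :=
    SchneiderFree.Upper.indexUpperBoundLeAt_of_imcUpperLe_of_control rfl hK hHN hfin hup ⟨n, hn, hneq⟩
  -- (c) TERMINAL STEP: a globally minimal model of the twist, then p528981
  have hD0 : (NumberField.discr K : ℚ) ≠ 0 := by exact_mod_cast NumberField.discr_ne_zero K
  haveI : (W.quadraticTwist (NumberField.discr K : ℚ)).IsElliptic := W.isElliptic_quadraticTwist hD0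
  obtain ⟨Cd, hCd⟩ := hasGlobalMinimalModel_rat_holds (W.quadraticTwist (NumberField.discr K : ℚ))
  haveI : (Cd • W.quadraticTwist (NumberField.discr K : ℚ)).IsGloballyMinimal := hCd
  exact SchneiderFree.Exact.bsdp_three_of_exactIndexManin_of_wAllExclAddWildRankZero hGZ hKo hGZK hmod
    hGZ73 hZ W hO6 hsurj hr (W.conductorNorm ℤ) K Dt H ι P
    (Cd • W.quadraticTwist (NumberField.discr K : ℚ)) rfl hK hodd hHN hLt hP ⟨Cd, rfl⟩ hlo hupI

end Summit.BirchSwinnertonDyer.BirchSwinnertonDyer.Theorems.UniversalToricDescentWaldspurgerFlat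

end
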